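import Mathlib
import HarnessLib
import Summits.KontsevichZagierPeriods.Zeta5Search.TwoTaleR3GrowthLimit
import Summits.KontsevichZagierPeriods.Zeta5Search.TwoTaleP15GrowthEnclosure
import Summits.KontsevichZagierPeriods.Zeta5Search.Certificates.LogEnclosures
import Summits.KontsevichZagierPeriods.Zeta5Search.Certificates.LogEnclosuresRecord

/-!
# TwoTaleR3GrowthEnclosure — the numerical input `C₁* ≤ 18.7553` at rung A is DISCHARGED

HONEST FRAMING: systematic search; no irrationality claim unless certified.

fam-measure (pub-zeta5), `families/measure/FAMILY.md` §10.5 / §10.10.  `TwoTaleR3Growth` / `TwoTaleR3GrowthLimit` prove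
the growth input of the rung-A measure implication modulo Whipple's identity: `log (qhatA n) / n → C₁starA :=
rateΛA ustarA`, where `ustarA` is SOME zero of `slopeGA` in `[9, 21/2]` chosen by the intermediate value theorem, and
leave the enclosure `C₁starA ≤ 18.7553` of fam-denom's sharp corollary `zetaTwo_exponent_le_of_inputsA` as a
hypothesis.  This file PROVES it (the rung-A port of `TwoTaleP15GrowthEnclosure`), without locating `ustarA`:

* `C₁starA_le_tangent` — the SUPPORTING-LINE inequality `C₁starA ≤ rateΛA u + ustarA·slopeGA u` for every
  `u ∈ (15/2, 11)`;
* `ustarA_window` — if `ustarA ≥ 61/6` then `(ustarA − 61/6)·m ≤ slopeGA (61/6)` with `m = 2/9 + 6/5 + 2/7 + 6/11`: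
  each of the six logarithmic terms of `slopeGA` is antitone, and four of them decrease at an explicit rate
  (`1 − a/b ≤ log b − log a`); since `slopeGA ustarA = 0` this pins `ustarA ≤ 61/6 + slopeGA (61/6) / m`
  (numerically `ustarA = 10.1680254`, `61/6 + slopeGA(61/6)/m = 10.1683587`);
* numerics ONLY at the rational abscissa `u = 61/6`, where the eight slope values are `3/5, 2/5, 12/43, 31/43, 5/6,
  1/6, 19/30, 11/30`: the cell's certified enclosures of `log 2, 3, 5, 6, 11, 12, 30`
  (`Certificates/LogEnclosures{,Record}`) plus `log 19, log 31, log 43` (proved here from `19 = 20·(1 − 1/20)`,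
  `31 = 32·(1 − 1/32)`, `43 = 44·(1 − 1/44)`, 12 terms each) give `0 ≤ slopeGA (61/6) ≤ 0.0038128` and
  `rateΛA (61/6) + (61/6)·slopeGA (61/6) ≤ 18.7552708`, whence **`C₁starA_le : C₁starA ≤ 18.7553`**
  (`18.7552708 + 0.001693·0.0038128 = 18.75527726`; the true value is `18.75527331…`);
* packaged, with NO numerical hypothesis left on the growth side:
  **`zetaTwo_exponent_le_of_whippleA₃ : InclusionA → DecayA 13.229 → WhippleA → ExponentLE (zetaValue 2) 5.2053`**
  (printed `5.20514736…` [Zudilin2014ZetaTwo, Remark 3]; better than Rhin–Viola's `5.441243`, not a record) and the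
  loose `zetaTwo_exponent_le_looseA_of_whipple₃ : InclusionA → DecayA 13.2 → WhippleA → ExponentLE (zetaValue 2) 5.233`.

NOTHING here certifies a measure: `InclusionA`, `DecayA` (fam-denom: the standard `Φ`-inclusions and the line-integral
bound at rung A — NO (bmiss) is needed at this rung) and `WhippleA` (a printed classical identity) remain named inputs.
References: W. Zudilin, arXiv:1310.1526 [Zudilin2014ZetaTwo] §6, Remarks 3 and 5; the enclosure method is the cell's
(`Certificates/LogEnclosures`, `Mathlib`'s `Real.abs_log_sub_add_sum_range_le`).
-/

noncomputable section

open Filter Topology Finset Real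

namespace Summit.KontsevichZagierPeriods.Zeta5Search.TwoTaleR3Growth

open Summit.KontsevichZagierPeriods.Zeta5Search.TwoTaleP15Growth (tendsto_log_linear_div)
open Summit.KontsevichZagierPeriods.Zeta5Search.LogEnclosures (log_one_sub_bounds log_two_bounds log_three_bounds
  log_five_bounds log_4_bounds log_6_bounds log_12_bounds log_16_bounds log_30_bounds log_11_bounds)

/-! ### (a) The supporting-line inequality -/

/-- **Supporting line:** for every `u` in the window, `C₁* ≤ Λ(u) + ustarA·G(u)` — the Chernoff tangent plane at
slopes `sᵢ(u)` lies above the max-term entropy, in particular above its value `C₁*` at the critical abscissa. -/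
theorem C₁starA_le_tangent {u : ℝ} (hu : 15 / 2 < u) (hu' : u < 11) : C₁starA ≤ rateΛA u + ustarA * slopeGA u := by
  have hA : Tendsto (fun n : ℕ => (constKA ustarA - penPA - 8) / (n : ℝ)) atTop (𝓝 0) :=
    tendsto_const_div_atTop_nhds_zero_nat _
  have hB : Tendsto (fun n : ℕ => Real.log (15 * n + 0) / (n : ℝ)) atTop (𝓝 0) :=
    tendsto_log_linear_div (by norm_num) le_rfl
  have hlo : Tendsto (fun n : ℕ => C₁starA + ((constKA ustarA - penPA - 8) / (n : ℝ) - 2 * (Real.log (15 * n + 0) / n)))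
      atTop (𝓝 C₁starA) := by
    simpa using tendsto_const_nhds.add (hA.sub (hB.const_mul 2))
  have hhi : Tendsto (fun n : ℕ => (rateΛA u + ustarA * slopeGA u) + (|slopeGA u| + constKA u) / (n : ℝ)) atTop
      (𝓝 (rateΛA u + ustarA * slopeGA u)) := by
    simpa using tendsto_const_nhds.add (tendsto_const_div_atTop_nhds_zero_nat (|slopeGA u| + constKA u))
  refine le_of_tendsto_of_tendsto hlo hhi ?_
  filter_upwards [eventually_ge_atTop 1] with n hn
  have hnpos : (0:ℝ) < n := by exact_mod_cast hn
  have h1 := exp_le_termA_kcrit hn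
  have hk : 7 * n + 1 ≤ kcritA n := by have := (kcritA_range hn).1; omega
  have h2 := termA_le_exp n (kcritA n) hk hu hu'
  have h12 := Real.exp_le_exp.mp (h1.trans h2)
  obtain ⟨hx0, hx1⟩ := kcritA_real n
  have hkG : (kcritA n : ℝ) * slopeGA u ≤ ustarA * n * slopeGA u + |slopeGA u| := by
    have hd : |((kcritA n : ℝ) - ustarA * n)| ≤ 1 := by rw [abs_le]; constructor <;> linarith
    have h3 : |((kcritA n : ℝ) - ustarA * n) * slopeGA u| ≤ |slopeGA u| := by
      rw [abs_mul]; exact mul_le_of_le_one_left (abs_nonneg _) hd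
    have h4 := (abs_le.mp h3).2
    linarith
  rw [add_zero]
  have e1 : C₁starA + ((constKA ustarA - penPA - 8) / (n : ℝ) - 2 * (Real.log (15 * n) / n)) =
      (n * C₁starA + constKA ustarA - penPA - 2 * Real.log (15 * n) - 8) / n := by
    field_simp; ring
  have e2 : rateΛA u + ustarA * slopeGA u + (|slopeGA u| + constKA u) / (n : ℝ) =
      (n * rateΛA u + ustarA * n * slopeGA u + |slopeGA u| + constKA u) / n := by
    field_simp; ring
  rw [e1, e2]
  exact div_le_div_of_nonneg_right (by linarith) hnpos.le

/-! ### (b) The one-sided window for `ustarA` -/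

-- lane edit (lead/lit g13, dedup.landed): `one_sub_div_le_log_sub_log'` was a copy of the landed
-- `TwoTaleP15Growth.one_sub_div_le_log_sub_log` (TwoTaleP15GrowthEnclosure.lean, p249877); that module is imported and reused.

/-- **Window:** if `ustarA ≥ 61/6` then `(ustarA − 61/6)·(2/9 + 6/5 + 2/7 + 6/11) ≤ slopeGA (61/6)`.  All six
logarithmic terms of `slopeGA` are antitone on `(15/2, 11)`; the terms `−log s₂`, `log(1 − s₂)`, `−log s₃`,
`log(1 − s₃)` drop between `61/6` and `ustarA ≤ 21/2` by at least `(ustarA − 61/6)·2/9`, `·6/5`, `·2/7`, `·6/11`, and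
`slopeGA ustarA = 0`. -/
theorem ustarA_window (hb : 61 / 6 ≤ ustarA) :
    (ustarA - 61 / 6) * (2 / 9 + 6 / 5 + 2 / 7 + 6 / 11) ≤ slopeGA (61 / 6) := by
  have hroot : slopeGA ustarA = 0 := ustarA_spec.2
  have hu2 : ustarA ≤ 21 / 2 := ustarA_spec.1.2
  obtain ⟨hu1, hu11⟩ := ustarA_bounds
  obtain ⟨⟨a0, b0⟩, ⟨a1, b1⟩, ⟨a2, b2⟩, ⟨a3, b3⟩⟩ := slopes_mem hu1 hu11
  have eG : slopeGA (61 / 6) = -2 * Real.log (2 / 5) - Real.log (31 / 43) - Real.log (5 / 6) + Real.log (1 / 6) -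
      Real.log (19 / 30) + Real.log (11 / 30) := by
    unfold slopeGA s₀ s₁ s₂ s₃; norm_num
  have eGu : slopeGA ustarA = -2 * Real.log (1 - s₀ ustarA) - Real.log (1 - s₁ ustarA) - Real.log (s₂ ustarA) +
      Real.log (1 - s₂ ustarA) - Real.log (s₃ ustarA) + Real.log (1 - s₃ ustarA) := rfl
  have hprod : 0 ≤ (ustarA - 61 / 6) * (21 / 2 - ustarA) := mul_nonneg (by linarith) (by linarith)
  -- T1, T2: antitone (no rate needed)
  have T1 : Real.log (2 / 5) ≤ Real.log (1 - s₀ ustarA) := by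
    apply Real.log_le_log (by norm_num)
    have : 8 / (2 * ustarA - 7) ≤ 3 / 5 := by
      rw [div_le_iff₀ (by linarith : (0:ℝ) < 2 * ustarA - 7)]; linarith
    unfold s₀; linarith
  have T2 : Real.log (31 / 43) ≤ Real.log (1 - s₁ ustarA) := by
    apply Real.log_le_log (by norm_num)
    have : 2 / (ustarA - 3) ≤ 12 / 43 := by
      rw [div_le_iff₀ (by linarith : (0:ℝ) < ustarA - 3)]; linarith
    unfold s₁; linarith
  -- T3: −log s₂ drops by ≥ (ustarA − 61/6)·2/9
  have T3 : (ustarA - 61 / 6) * (2 / 9) ≤ Real.log (s₂ ustarA) - Real.log (5 / 6) := by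
    have h := TwoTaleP15Growth.one_sub_div_le_log_sub_log (by norm_num : (0:ℝ) < 5 / 6) a2
    have h' : (5 / 6) / s₂ ustarA ≤ 1 - (ustarA - 61 / 6) * (2 / 9) := by
      rw [div_le_iff₀ a2]; unfold s₂; nlinarith [hprod]
    linarith
  -- T4: log(1 − s₂) drops by ≥ (ustarA − 61/6)·6/5
  have T4 : (ustarA - 61 / 6) * (6 / 5) ≤ Real.log (1 / 6) - Real.log (1 - s₂ ustarA) := by
    have h := TwoTaleP15Growth.one_sub_div_le_log_sub_log (by linarith : (0:ℝ) < 1 - s₂ ustarA) (by norm_num : (0:ℝ) < 1 / 6)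
    have e : 1 - (1 - s₂ ustarA) / (1 / 6) = (ustarA - 61 / 6) * (6 / 5) := by unfold s₂; ring
    linarith
  -- T5: −log s₃ drops by ≥ (ustarA − 61/6)·2/7
  have T5 : (ustarA - 61 / 6) * (2 / 7) ≤ Real.log (s₃ ustarA) - Real.log (19 / 30) := by
    have h := TwoTaleP15Growth.one_sub_div_le_log_sub_log (by norm_num : (0:ℝ) < 19 / 30) a3
    have h' : (19 / 30) / s₃ ustarA ≤ 1 - (ustarA - 61 / 6) * (2 / 7) := by
      rw [div_le_iff₀ a3]; unfold s₃; nlinarith [hprod]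
    linarith
  -- T6: log(1 − s₃) drops by ≥ (ustarA − 61/6)·6/11
  have T6 : (ustarA - 61 / 6) * (6 / 11) ≤ Real.log (11 / 30) - Real.log (1 - s₃ ustarA) := by
    have h := TwoTaleP15Growth.one_sub_div_le_log_sub_log (by linarith : (0:ℝ) < 1 - s₃ ustarA) (by norm_num : (0:ℝ) < 11 / 30)
    have e : 1 - (1 - s₃ ustarA) / (11 / 30) = (ustarA - 61 / 6) * (6 / 11) := by unfold s₃; ring
    linarith
  rw [eG]
  rw [eGu] at hroot
  linarith

/-! ### (c) Certified numerics at `u = 61/6` -/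

/-- `log 19` to 12 decimals (`19 = 4·5·(1 − 1/20)`, 12 terms of the series). -/
theorem log_19_bounds : (2.944438979166 : ℝ) ≤ Real.log 19 ∧ Real.log 19 ≤ 2.944438979167 := by
  have hx : |(1 / 20 : ℝ)| < 1 := by rw [abs_of_pos (by norm_num : (0 : ℝ) < 1 / 20)]; norm_num
  have h := log_one_sub_bounds hx 12
  rw [abs_of_pos (by norm_num : (0 : ℝ) < 1 / 20)] at h
  simp only [sum_range_succ, sum_range_zero] at h
  norm_num at h
  have hN : Real.log (19 : ℝ) = Real.log 4 + Real.log 5 + Real.log (1 - 1 / 20) := by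
    rw [show (19 : ℝ) = 4 * 5 * (1 - 1 / 20) by norm_num]
    rw [Real.log_mul (by norm_num) (by norm_num), Real.log_mul (by norm_num) (by norm_num)]
  obtain ⟨p1, p2⟩ := log_4_bounds
  obtain ⟨r1, r2⟩ := log_five_bounds
  rw [hN]
  constructor <;> linarith [h.1, h.2]

/-- `log 31` to 12 decimals (`31 = 2·16·(1 − 1/32)`, 12 terms of the series). -/
theorem log_31_bounds : (3.433987204485 : ℝ) ≤ Real.log 31 ∧ Real.log 31 ≤ 3.433987204486 := by
  have hx : |(1 / 32 : ℝ)| < 1 := by rw [abs_of_pos (by norm_num : (0 : ℝ) < 1 / 32)]; norm_num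
  have h := log_one_sub_bounds hx 12
  rw [abs_of_pos (by norm_num : (0 : ℝ) < 1 / 32)] at h
  simp only [sum_range_succ, sum_range_zero] at h
  norm_num at h
  have hN : Real.log (31 : ℝ) = Real.log 2 + Real.log 16 + Real.log (1 - 1 / 32) := by
    rw [show (31 : ℝ) = 2 * 16 * (1 - 1 / 32) by norm_num]
    rw [Real.log_mul (by norm_num) (by norm_num), Real.log_mul (by norm_num) (by norm_num)]
  obtain ⟨p1, p2⟩ := log_two_bounds
  obtain ⟨r1, r2⟩ := log_16_bounds
  rw [hN]
  constructor <;> linarith [h.1, h.2]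

/-- `log 43` to 12 decimals (`43 = 4·11·(1 − 1/44)`, 12 terms of the series). -/
theorem log_43_bounds : (3.761200115693 : ℝ) ≤ Real.log 43 ∧ Real.log 43 ≤ 3.761200115694 := by
  have hx : |(1 / 44 : ℝ)| < 1 := by rw [abs_of_pos (by norm_num : (0 : ℝ) < 1 / 44)]; norm_num
  have h := log_one_sub_bounds hx 12
  rw [abs_of_pos (by norm_num : (0 : ℝ) < 1 / 44)] at h
  simp only [sum_range_succ, sum_range_zero] at h
  norm_num at h
  have hN : Real.log (43 : ℝ) = Real.log 4 + Real.log 11 + Real.log (1 - 1 / 44) := by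
    rw [show (43 : ℝ) = 4 * 11 * (1 - 1 / 44) by norm_num]
    rw [Real.log_mul (by norm_num) (by norm_num), Real.log_mul (by norm_num) (by norm_num)]
  obtain ⟨p1, p2⟩ := log_4_bounds
  obtain ⟨r1, r2⟩ := log_11_bounds
  rw [hN]
  constructor <;> linarith [h.1, h.2]

/-- The three certified inequalities at `u = 61/6`: `0 ≤ slopeGA (61/6) ≤ 0.0038128` and
`rateΛA (61/6) + (61/6)·slopeGA (61/6) ≤ 18.7552708` (true values `0.00381275615…`, `18.75527071833…`). -/
theorem numerics_at_61_6 :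
    0 ≤ slopeGA (61 / 6) ∧ slopeGA (61 / 6) ≤ 0.0038128 ∧
      rateΛA (61 / 6) + 61 / 6 * slopeGA (61 / 6) ≤ 18.7552708 := by
  have eG : slopeGA (61 / 6) = -2 * Real.log (2 / 5) - Real.log (31 / 43) - Real.log (5 / 6) + Real.log (1 / 6) -
      Real.log (19 / 30) + Real.log (11 / 30) := by
    unfold slopeGA s₀ s₁ s₂ s₃; norm_num
  have eΛ : rateΛA (61 / 6) = -8 * Real.log (3 / 5) + 15 * Real.log (2 / 5) - 2 * Real.log (12 / 43) +
      5 * Real.log (31 / 43) + 6 * Real.log (5 / 6) - 11 * Real.log (1 / 6) + 7 * Real.log (19 / 30) -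
      12 * Real.log (11 / 30) := by
    unfold rateΛA s₀ s₁ s₂ s₃; norm_num
  have d1 : Real.log (3 / 5) = Real.log 3 - Real.log 5 := Real.log_div (by norm_num) (by norm_num)
  have d2 : Real.log (2 / 5) = Real.log 2 - Real.log 5 := Real.log_div (by norm_num) (by norm_num)
  have d3 : Real.log (12 / 43) = Real.log 12 - Real.log 43 := Real.log_div (by norm_num) (by norm_num)
  have d4 : Real.log (31 / 43) = Real.log 31 - Real.log 43 := Real.log_div (by norm_num) (by norm_num)
  have d5 : Real.log (5 / 6) = Real.log 5 - Real.log 6 := Real.log_div (by norm_num) (by norm_num)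
  have d6 : Real.log (1 / 6) = Real.log 1 - Real.log 6 := Real.log_div (by norm_num) (by norm_num)
  have d7 : Real.log (19 / 30) = Real.log 19 - Real.log 30 := Real.log_div (by norm_num) (by norm_num)
  have d8 : Real.log (11 / 30) = Real.log 11 - Real.log 30 := Real.log_div (by norm_num) (by norm_num)
  obtain ⟨p1, p2⟩ := log_two_bounds
  obtain ⟨q1, q2⟩ := log_three_bounds
  obtain ⟨r1, r2⟩ := log_five_bounds
  obtain ⟨s1, s2⟩ := log_6_bounds
  obtain ⟨e1, e2⟩ := log_11_bounds
  obtain ⟨w1, w2⟩ := log_12_bounds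
  obtain ⟨x1, x2⟩ := log_30_bounds
  obtain ⟨v1, v2⟩ := log_19_bounds
  obtain ⟨y1, y2⟩ := log_31_bounds
  obtain ⟨z1, z2⟩ := log_43_bounds
  rw [eG, eΛ, d1, d2, d3, d4, d5, d6, d7, d8, Real.log_one]
  refine ⟨by linarith, by linarith, by linarith⟩

/-! ### (d) The enclosure and the hypothesis-free packaging -/

/-- **`C₁* ≤ 18.7553`** at rung A (true value `18.75527331…`): supporting line at `u = 61/6` plus the window. -/
theorem C₁starA_le : C₁starA ≤ 18.7553 := by
  have ht := C₁starA_le_tangent (by norm_num : (15:ℝ) / 2 < 61 / 6) (by norm_num : (61:ℝ) / 6 < 11)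
  obtain ⟨g0, g1, hH⟩ := numerics_at_61_6
  rcases le_or_gt ustarA (61 / 6) with h | h
  · have : ustarA * slopeGA (61 / 6) ≤ 61 / 6 * slopeGA (61 / 6) := mul_le_mul_of_nonneg_right h g0
    linarith
  · have hw := ustarA_window h.le
    have hx : ustarA - 61 / 6 ≤ 0.001693 := by linarith
    have hxG : (ustarA - 61 / 6) * slopeGA (61 / 6) ≤ 0.001693 * 0.0038128 :=
      mul_le_mul hx g1 g0 (by norm_num)
    nlinarith

section Packaged

open Literature.NumberTheory.Transcendental (zetaValue)
open Summit.KontsevichZagierPeriods.Zeta5Search.Denom.TwoTaleR3Saving (savingRateA savingRateA_bounds)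
open Summit.KontsevichZagierPeriods.Zeta5Search.Denom.TwoTaleR3Forms (InclusionA DecayA)

/-- **Rung A, three inputs:** `InclusionA → DecayA 13.229 → WhippleA → μ(ζ(2)) ≤ 5.2053` (printed value with the
exact constants `5.20514736…`, arXiv:1310.1526 Remark 3; NOT a record — the point of rung A is that its `DecayA`
needs NO missing-zero input (bmiss)). -/
theorem zetaTwo_exponent_le_of_whippleA₃ (hI : InclusionA) (hD : DecayA 13.229) (hW : WhippleA) :
    ExponentLE (zetaValue 2) 5.2053 := by
  have hS := savingRateA_bounds
  have hC := C₁starA_le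
  have h := exponentLE_of_whippleA hI hD hW (by linarith [hS.1])
  have hden : 0 < 13.229 - (14 - savingRateA) := by linarith [hS.1]
  have hle : 1 + (C₁starA + (14 - savingRateA)) / (13.229 - (14 - savingRateA)) ≤ 5.2053 := by
    have h1 : (C₁starA + (14 - savingRateA)) / (13.229 - (14 - savingRateA)) ≤ 4.2053 := by
      rw [div_le_iff₀ hden]; nlinarith [hS.1]
    linarith
  exact h.mono hle

/-- fam-denom's sharp corollary `zetaTwo_exponent_le_of_inputsA` with BOTH growth hypotheses discharged:
`InclusionA → DecayA 13.229 → WhippleA → μ(ζ(2)) ≤ 5.2054`. -/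
theorem zetaTwo_exponent_le_of_whippleA₃' (hI : InclusionA) (hD : DecayA 13.229) (hW : WhippleA) :
    ExponentLE (zetaValue 2) 5.2054 :=
  zetaTwo_exponent_le_of_whippleA hI hD hW C₁starA_le

/-- **Rung A, loose decay constant:** `InclusionA → DecayA 13.2 → WhippleA → μ(ζ(2)) ≤ 5.233`. -/
theorem zetaTwo_exponent_le_looseA_of_whipple₃ (hI : InclusionA) (hD : DecayA 13.2) (hW : WhippleA) :
    ExponentLE (zetaValue 2) 5.233 :=
  zetaTwo_exponent_le_looseA_of_whipple hI hD hW (by linarith [C₁starA_le])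

end Packaged

end Summit.KontsevichZagierPeriods.Zeta5Search.TwoTaleR3Growth

end
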